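import Literature.MathematicalPhysics.QuantumFieldTheory.Balaban1983to89.B12Eq213CouplingDependence
import Literature.MathematicalPhysics.QuantumFieldTheory.Balaban1983to89.B12Eq213CutoffDependence
import Literature.MathematicalPhysics.QuantumFieldTheory.Balaban1983to89.B12Eq213GaussianTiltedMoments

/-!
# `Balaban1983to89.B12Eq213GaussianLastCoupling` — T. Bałaban, *Renormalization group approach to lattice gauge field
theories. I*, Commun. Math. Phys. **109** (1987) 249–301 [Balaban1987RG1], (2.13) p. 268 with p. 263 ll. 22–28 and (2.9)
p. 266; *… II. Cluster expansions*, Commun. Math. Phys. **116** (1988) 1–22 [Balaban1988RG2Cluster], (2.20)–(2.22) p. 16,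
(2.25) p. 17: **THE LAST-COUPLING MODULUS OF THE (2.13) NEW TERM AT ITS GAUSSIAN DATUM, EFFECTIVE — both `g_k`-channels (the
exponent and the small-field cut-off) bounded by explicit Gaussian quantities under a (2.20)-type quadratic domination; the
assembly of the seat's body-level chain, kernel-checked**

statement-level skeleton of published theorems with citation tags; proofs where landed; nothing here is a claim about
the Yang–Mills mass gap

PDF held: `paper:balaban1987-cmp109-rg-i-small-field` (journal page = PDF page + 248), `paper:balaban1988-cmp116-rg-ii-cluster`;
pp. 263, 266, 268 of [I] re-read this session; (2.20)–(2.25) of [II] through the tree's certified readings.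

CITATION HEADER / WHAT IS REPRODUCED (cell `pub-ymgap`, HUMAN RULING D-0062 Track A, seat `pub-ymgap-dag-n22-b` = the
FIRST-MISSING-ESTIMATE seat of DAG node N22 = NE9; fifth module = the ASSEMBLY of the body-level chain: `B12Eq213CouplingDependence`
v1.1 (p409833: differentiation under (2.13) with general domination, tilted-expectation bound), `B12Eq213CutoffDependence` (p409359:
cut-off channel, (2.22) device), `B12Eq213GaussianTiltedMoments` (p410261: (2.25) at a general precision, tilted moments) — all BY
NAME, nothing modified).

THE PRINT.  [I] p. 263 ll. 22–28: *«It is a C^∞-function of g_{j−1} ∈ [0, γ], (or analytic), with a positive, absolute γ»* — no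
modulus printed; (2.13) p. 268; (2.9) p. 266 (the cut-off, `|B(b)| < ε₁g_k⁻¹` in the integration variable, [II] (1.34)); [II] (2.20)
p. 16 (quadratic domination of the exponent), (2.22) p. 16 (Chebyshev on the large field), (2.25) p. 17 (Gaussian integral of a small
quadratic exponential).  The printed uses of (2.20)–(2.25) are inside the cluster expansion; here they are applied to the un-localised
(2.13) body at its Gaussian datum — the same mechanism, NOT print's statement.

WHAT THIS MODULE DOES (THEOREMS ONLY; no definition, no named fact).  `M = prec U` positive definite, `R(c) := √(det M)∕√(det(M − c·1))`.
* §1 `integrable_gaussProb_iff` — integrability against `gaussProb M` is integrability of `e^{−½⟨B,MB⟩}·f` against Lebesgue measure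
  (plumbing between r20's `gaussProb` and the `gaussWeight` currency of `B13Integral223` ∕ module 4).
* §2 **`hasDerivAt_newTerm_gaussian_of_quadDom`** — THE EXPONENT CHANNEL, EFFECTIVE: if on a coupling ball around `g₀` the exponent
  `𝐏^{(k)} + {…}` is `g`-differentiable on the small-field support with `|𝐏^{(k)} + {…}| ≤ a₀ + ½α|B|²` and `|∂_g(𝐏^{(k)} + {…})| ≤
  m₀ + ½m₂|B|²` ((2.20) TYPE), `M − α·1` and `M − (α+δ)·1` positive definite, the damped small-field mass `∫ χ_U e^{−½α|B|²} dμ_{M⁻¹}`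
  positive (and the integrands measurable), then `g ↦ 𝐄^{(k+1)}(g, U)` is differentiable at `g₀` and
  `|∂_g 𝐄^{(k+1)}(g₀, U)| ≤ e^{2a₀}·(m₀·R(α) + (m₂∕δ)·R(α+δ)) ∕ ∫ χ_U e^{−½α|B|²} dμ_{M⁻¹}` — p. 263's clause at first order WITH A
  MODULUS, for the Gaussian body.
* §3 **`cutoffChannel_gaussian_le`** — THE CUT-OFF CHANNEL, EFFECTIVE: for two windows `χ ≤ χ′` whose difference lives on the large field of
  finitely many coordinates `b ∈ S` at radius `r` (nested product cut-offs), the same domination on the support of `χ′`, `γ₂ ≥ 0` with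
  `M − (α+γ₂)·1` positive definite:
  `𝐄′^{(k+1)}(g, U) − 𝐄^{(k+1)}(g, U) ≤ e^{−½γ₂r²} · #S · e^{2a₀}·R(α+γ₂) ∕ ∫ χ_U e^{−½α|B|²} dμ_{M⁻¹}` — with `r = ε₁∕g_k` the factor
  `exp(−½γ₂ε₁²∕g_k²)` of (2.22), times explicit Gaussian quantities.
HONEST READING: these are the last-coupling moduli of the UN-LOCALISED new term of ONE step on the body of record, with every constant a
Gaussian quantity of the datum; what turns them into statements about Bałaban's `𝐄^{(k+1)}(X)` is localization + the object W1 (NODE 00 ∕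
substrate S-U3) + the (2.20) domination of Bałaban's exponent ([II] Lemma 2, node N10) + the differentiability of Bałaban's exponent in
`g_k` ((2.12)'s explicit `𝐏^{(k)}`, (1.17) analyticity of the old action) — all displayed, none asserted.

v1.1 (same seat, APPEND-ONLY; §§1–3 byte-identical to v1): §4 `abs_newTerm_sub_newTerm_gaussian_of_quadDom` — the same hypotheses on a
whole coupling ball give, by the mean value theorem, the LIPSCHITZ MODULUS `Λ = e^{2a₀}(m₀R(α) + (m₂∕δ)R(α+δ))∕mass` of
`g ↦ 𝐄^{(k+1)}(g, U)` on the ball — the per-step input `hN` of the history tower `B12Eq213HistoryTower.abs_action_sub_action_le_tower_of_lip`.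

WHAT IS *NOT* HERE: higher derivatives ∕ C^∞; the history side (modules `B12Eq213CouplingDependence` §3, `B12Eq213HistoryTower`);
localization.  HONEST FRAMING: count-neutral Track-A side module; NOT a discharge of node N22; one finite T⁴ programme at fixed ε,
Bałaban AS PRINTED with locators; nothing continuum ∕ ℝ⁴ ∕ OS ∕ mass-gap ∕ Clay.
-/

noncomputable section

namespace Literature.MathematicalPhysics.QuantumFieldTheory.Balaban1983to89.B12Eq213GaussianLastCoupling

open _root_.MeasureTheory Matrix
open scoped BigOperators ENNReal
open Literature.MathematicalPhysics.QuantumFieldTheory.Balaban1983to89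
open Literature.MathematicalPhysics.QuantumFieldTheory.Balaban1983to89.B12Eq213Body268 (FluctData)
open Literature.MathematicalPhysics.QuantumFieldTheory.Balaban1983to89.B13GaugeDevices (gaussWeight gaussNorm gaussMean gaussInt)
open Literature.MathematicalPhysics.QuantumFieldTheory.Balaban1983to89.B2Eq228Conditioning (gaussProb gaussNorm_pos gaussWeight_pos
  integrable_gaussWeight measurable_gaussWeight_real)
open Literature.MathematicalPhysics.QuantumFieldTheory.Balaban1983to89.B12Eq213CouplingDependence
open Literature.MathematicalPhysics.QuantumFieldTheory.Balaban1983to89.B12Eq213CutoffDependence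
open Literature.MathematicalPhysics.QuantumFieldTheory.Balaban1983to89.B12Eq213GaussianTiltedMoments

/-! ## §1. Integrability against `gaussProb M` versus the weight currency -/

section Plumbing

variable {κ : Type} [Fintype κ] [DecidableEq κ]

/-- Integrability against the normalised Gaussian `dμ_{M⁻¹} = gaussProb M` (`M` positive definite; the tree's reading of the
*«probabilistic Gaussian measure with the covariance A_Λ⁻¹»* of [Balaban1982Higgs2] (2.28), `B2Eq228Conditioning.gaussProb`) is
integrability of `e^{−½⟨B, MB⟩}·f` against Lebesgue measure (plumbing: `gaussProb` is Lebesgue measure with that density, normalised).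
[cite: Balaban1982Higgs2, (2.28) p.563] -/
theorem integrable_gaussProb_iff {M : Matrix κ κ ℝ} (hM : M.PosDef) (f : (κ → ℝ) → ℝ) :
    Integrable f (gaussProb M) ↔ Integrable (fun B => gaussWeight M B * f B) := by
  have hmeas : Measurable (fun x : κ → ℝ => ENNReal.ofReal (gaussWeight M x)) :=
    (measurable_gaussWeight_real M).ennreal_ofReal
  have hc0 : ENNReal.ofReal (gaussNorm M)⁻¹ ≠ 0 :=
    (ENNReal.ofReal_pos.2 (inv_pos.2 (gaussNorm_pos hM))).ne'
  rw [gaussProb, integrable_smul_measure hc0 ENNReal.ofReal_ne_top,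
    integrable_withDensity_iff_integrable_smul' hmeas (Filter.Eventually.of_forall fun _ => ENNReal.ofReal_lt_top)]
  refine integrable_congr (Filter.Eventually.of_forall fun B => ?_)
  show (ENNReal.ofReal (gaussWeight M B)).toReal • f B = gaussWeight M B * f B
  rw [ENNReal.toReal_ofReal (gaussWeight_pos M B).le, smul_eq_mul]

omit [DecidableEq κ] in
/-- `|B|² ≤ (2∕δ)·e^{½δ|B|²}` for `δ > 0` (plumbing, as in module 4). [folklore] -/
private theorem sq_le_exp_sq' {δ : ℝ} (hδ : 0 < δ) (x : κ → ℝ) :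
    x ⬝ᵥ x ≤ 2 / δ * Real.exp (δ / 2 * (x ⬝ᵥ x)) := by
  have h := Real.add_one_le_exp (δ / 2 * (x ⬝ᵥ x))
  have hx : 0 ≤ x ⬝ᵥ x := Finset.sum_nonneg fun i _ => mul_self_nonneg (x i)
  rw [div_mul_eq_mul_div, le_div_iff₀ hδ]
  nlinarith

/-- The exponential majorant `e^{a₀}(m₀e^{½α|B|²} + (m₂∕δ)e^{½(α+δ)|B|²})` is `gaussProb M`-integrable when `M − α·1` and
`M − (α+δ)·1` are positive definite (plumbing). [folklore] -/
private theorem integrable_majorant {M : Matrix κ κ ℝ} (hM : M.PosDef) {α δ : ℝ} (a₀ m₀ m₂ : ℝ)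
    (hMα : (M - α • (1 : Matrix κ κ ℝ)).PosDef) (hMδ : (M - (α + δ) • (1 : Matrix κ κ ℝ)).PosDef) :
    Integrable (fun B : κ → ℝ => Real.exp a₀ * (m₀ * Real.exp (α / 2 * (B ⬝ᵥ B))
      + m₂ / δ * Real.exp ((α + δ) / 2 * (B ⬝ᵥ B)))) (gaussProb M) := by
  rw [integrable_gaussProb_iff hM]
  have hI1 : Integrable (fun B : κ → ℝ => gaussWeight M B * Real.exp (α / 2 * (B ⬝ᵥ B))) := by
    refine (integrable_gaussWeight hMα).congr (Filter.Eventually.of_forall fun B => ?_)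
    simp only [← gaussWeight_mul_exp_sq]
  have hI2 : Integrable (fun B : κ → ℝ => gaussWeight M B * Real.exp ((α + δ) / 2 * (B ⬝ᵥ B))) := by
    refine (integrable_gaussWeight hMδ).congr (Filter.Eventually.of_forall fun B => ?_)
    simp only [← gaussWeight_mul_exp_sq]
  have h := ((hI1.const_mul m₀).add (hI2.const_mul (m₂ / δ))).const_mul (Real.exp a₀)
  refine h.congr (Filter.Eventually.of_forall fun B => ?_)
  simp only [Pi.add_apply]
  ring

end Plumbing

/-! ## §2. The exponent channel of the last coupling, effective for the Gaussian body -/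

section Exponent

variable {X : Type*} {κ : Type} [Fintype κ] [DecidableEq κ]
variable (prec : X → Matrix κ κ ℝ) (hpd : ∀ U, (prec U).PosDef) (χ : X → (κ → ℝ) → ℝ) (h0 : ∀ U B, 0 ≤ χ U B)
  (h1 : ∀ U B, χ U B ≤ 1) (P Q : ℝ → X → (κ → ℝ) → ℝ)

/-- **p. 263's CLAUSE AT FIRST ORDER WITH A MODULUS, FOR THE GAUSSIAN BODY.**  At the Gaussian datum of (2.13) (measures
`gaussProb (prec U)`), let the exponent `𝐏^{(k)} + {…}` be `g`-differentiable with derivative `e′ g B` on a coupling ball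
`|g − g₀| < ε` for every `B` in the support of `χ_U`, with the (2.20)-type dominations `|𝐏^{(k)} + {…}| ≤ a₀ + ½α|B|²` and
`|e′| ≤ m₀ + ½m₂|B|²` there; let `M − α·1`, `M − (α+δ)·1` be positive definite (`M = prec U`, `δ > 0`), the damped small-field mass
`∫ χ_U e^{−½α|B|²} dμ_{M⁻¹}` positive, and the integrands ∕ `e′(g₀)` measurable.  Then `g ↦ 𝐄^{(k+1)}(g, U)` is differentiable at `g₀`
with derivative the tilted expectation of `e′(g₀)`, and
`|∂_g 𝐄^{(k+1)}(g₀, U)| ≤ e^{2a₀}·(m₀·√(det M∕det(M−α·1)) + (m₂∕δ)·√(det M∕det(M−(α+δ)·1))) ∕ ∫ χ_U e^{−½α|B|²} dμ_{M⁻¹}`.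
[cite: Balaban1987RG1, (2.13) p.268 and p.263 (clause before (1.18)); Balaban1988RG2Cluster, (2.20) p.16 and (2.25) p.17] -/
theorem hasDerivAt_newTerm_gaussian_of_quadDom {U : X} {g₀ ε a₀ α δ m₀ m₂ : ℝ} (e' : ℝ → (κ → ℝ) → ℝ) (hε : 0 < ε)
    (hm₀ : 0 ≤ m₀) (hm₂ : 0 ≤ m₂) (hδ : 0 < δ)
    (hmeas : ∀ g ∈ Metric.ball g₀ ε,
      AEStronglyMeasurable (fun B => χ U B * Real.exp (P g U B + Q g U B)) (gaussProb (prec U)))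
    (he' : AEStronglyMeasurable (e' g₀) (gaussProb (prec U)))
    (hdiff : ∀ B, χ U B ≠ 0 → ∀ g ∈ Metric.ball g₀ ε, HasDerivAt (fun g => P g U B + Q g U B) (e' g B) g)
    (hdom : ∀ B, χ U B ≠ 0 → ∀ g ∈ Metric.ball g₀ ε, |P g U B + Q g U B| ≤ a₀ + α / 2 * (B ⬝ᵥ B))
    (hder : ∀ B, χ U B ≠ 0 → ∀ g ∈ Metric.ball g₀ ε, |e' g B| ≤ m₀ + m₂ / 2 * (B ⬝ᵥ B))
    (hMα : (prec U - α • (1 : Matrix κ κ ℝ)).PosDef) (hMδ : (prec U - (α + δ) • (1 : Matrix κ κ ℝ)).PosDef)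
    (hmass : 0 < ∫ B, χ U B * Real.exp (-(α / 2 * (B ⬝ᵥ B))) ∂(gaussProb (prec U))) :
    HasDerivAt (fun g => (FluctData.gaussian prec hpd χ h0 h1 P Q).newTerm g U)
        (((FluctData.gaussian prec hpd χ h0 h1 P Q).integral g₀ U)⁻¹ *
          ∫ B, (FluctData.gaussian prec hpd χ h0 h1 P Q).integrand g₀ U B * e' g₀ B ∂(gaussProb (prec U))) g₀ ∧
      |((FluctData.gaussian prec hpd χ h0 h1 P Q).integral g₀ U)⁻¹ *
          ∫ B, (FluctData.gaussian prec hpd χ h0 h1 P Q).integrand g₀ U B * e' g₀ B ∂(gaussProb (prec U))|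
        ≤ Real.exp (2 * a₀) * (m₀ * (Real.sqrt (prec U).det / Real.sqrt (prec U - α • (1 : Matrix κ κ ℝ)).det)
            + m₂ / δ * (Real.sqrt (prec U).det / Real.sqrt (prec U - (α + δ) • (1 : Matrix κ κ ℝ)).det))
          / ∫ B, χ U B * Real.exp (-(α / 2 * (B ⬝ᵥ B))) ∂(gaussProb (prec U)) := by
  set D := FluctData.gaussian prec hpd χ h0 h1 P Q with hD
  have hμ : D.μ U = gaussProb (prec U) := rfl
  have hintg : ∀ g B, D.integrand g U B = χ U B * Real.exp (P g U B + Q g U B) := fun g B => rfl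
  have hexp : ∀ g B, D.exponent g U B = P g U B + Q g U B := fun g B => rfl
  have hg₀ : g₀ ∈ Metric.ball g₀ ε := Metric.mem_ball_self hε
  -- the exponential majorant and the two dominations of the integrand
  set bound : (κ → ℝ) → ℝ := fun B => Real.exp a₀ * (m₀ * Real.exp (α / 2 * (B ⬝ᵥ B))
      + m₂ / δ * Real.exp ((α + δ) / 2 * (B ⬝ᵥ B))) with hbound
  have hbound_int : Integrable bound (D.μ U) := integrable_majorant (hpd U) a₀ m₀ m₂ hMα hMδ
  have hmaj : ∀ B, χ U B ≠ 0 → ∀ g ∈ Metric.ball g₀ ε, ∀ w : ℝ, |w| ≤ m₀ + m₂ / 2 * (B ⬝ᵥ B) →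
      |D.integrand g U B * w| ≤ bound B := by
    intro B hB g hg w hw
    have hx : 0 ≤ B ⬝ᵥ B := Finset.sum_nonneg fun i _ => mul_self_nonneg (B i)
    have hb := (abs_le.1 (hdom B hB g hg)).2
    rw [hintg, abs_mul, abs_of_nonneg (mul_nonneg (h0 U B) (Real.exp_nonneg _))]
    have hF : χ U B * Real.exp (P g U B + Q g U B) ≤ Real.exp a₀ * Real.exp (α / 2 * (B ⬝ᵥ B)) := by
      calc χ U B * Real.exp (P g U B + Q g U B) ≤ 1 * Real.exp (a₀ + α / 2 * (B ⬝ᵥ B)) :=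
            mul_le_mul (h1 U B) (Real.exp_le_exp.2 hb) (Real.exp_nonneg _) zero_le_one
        _ = Real.exp a₀ * Real.exp (α / 2 * (B ⬝ᵥ B)) := by rw [one_mul, Real.exp_add]
    have hsq := sq_le_exp_sq' hδ B
    have hm : |w| ≤ m₀ + m₂ / 2 * (2 / δ * Real.exp (δ / 2 * (B ⬝ᵥ B))) := by nlinarith
    calc χ U B * Real.exp (P g U B + Q g U B) * |w|
        ≤ (Real.exp a₀ * Real.exp (α / 2 * (B ⬝ᵥ B))) * (m₀ + m₂ / 2 * (2 / δ * Real.exp (δ / 2 * (B ⬝ᵥ B)))) :=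
          mul_le_mul hF hm (abs_nonneg _) (by positivity)
      _ = bound B := by
          have e : Real.exp ((α + δ) / 2 * (B ⬝ᵥ B)) = Real.exp (α / 2 * (B ⬝ᵥ B)) * Real.exp (δ / 2 * (B ⬝ᵥ B)) := by
            rw [← Real.exp_add]; ring_nf
          simp only [hbound, e]
          ring
  -- integrability of the integrand at g₀ (domination with w = 1 is not of the required shape; use the exponent bound directly)
  have hint : Integrable (D.integrand g₀ U) (D.μ U) := by
    have hmajI : Integrable (fun B : κ → ℝ => Real.exp a₀ * Real.exp (α / 2 * (B ⬝ᵥ B))) (gaussProb (prec U)) := by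
      rw [integrable_gaussProb_iff (hpd U)]
      have h := (integrable_gaussWeight hMα).const_mul (Real.exp a₀)
      refine h.congr (Filter.Eventually.of_forall fun B => ?_)
      simp only [← gaussWeight_mul_exp_sq]
      ring
    refine hmajI.mono' (hmeas g₀ hg₀) (Filter.Eventually.of_forall fun B => ?_)
    rw [Real.norm_eq_abs, hintg, abs_of_nonneg (mul_nonneg (h0 U B) (Real.exp_nonneg _))]
    by_cases hB : χ U B = 0
    · rw [hB, zero_mul]; positivity
    · have hb := (abs_le.1 (hdom B hB g₀ hg₀)).2
      calc χ U B * Real.exp (P g₀ U B + Q g₀ U B) ≤ 1 * Real.exp (a₀ + α / 2 * (B ⬝ᵥ B)) :=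
            mul_le_mul (h1 U B) (Real.exp_le_exp.2 hb) (Real.exp_nonneg _) zero_le_one
        _ = Real.exp a₀ * Real.exp (α / 2 * (B ⬝ᵥ B)) := by rw [one_mul, Real.exp_add]
  -- positivity of the integral through the damped small-field mass
  have hintW : Integrable (fun B => gaussWeight (prec U) B * (χ U B * Real.exp (P g₀ U B + Q g₀ U B))) :=
    (integrable_gaussProb_iff (hpd U) _).1 hint
  have hlow := integral_gaussian_ge_of_quadDom prec hpd χ h0 h1 P Q (fun B hB => hdom B hB g₀ hg₀) hintW
  have hden_pos : 0 < Real.exp (-a₀) * ∫ B, χ U B * Real.exp (-(α / 2 * (B ⬝ᵥ B))) ∂(gaussProb (prec U)) :=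
    mul_pos (Real.exp_pos _) hmass
  have hpos : 0 < D.integral g₀ U := hden_pos.trans_le hlow
  -- the derivative
  have hderiv := hasDerivAt_newTerm_of_dominated D e' bound hε (fun g hg => hmeas g hg) hint he'
    (fun B hB g hg => hdiff B hB g hg) (fun B hB g hg => hmaj B hB g hg (e' g B) (hder B hB g hg)) hbound_int hpos
  refine ⟨hderiv, ?_⟩
  -- the bound: tilted expectation of the majorant m₀ + ½m₂|B|², then module 4's numerator and lower bound
  have hmI : Integrable (fun B => D.integrand g₀ U B * (m₀ + m₂ / 2 * (B ⬝ᵥ B))) (D.μ U) := by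
    refine hbound_int.mono' ((hmeas g₀ hg₀).mul (Continuous.aestronglyMeasurable (by fun_prop)))
      (Filter.Eventually.of_forall fun B => ?_)
    rw [Real.norm_eq_abs]
    by_cases hB : χ U B = 0
    · have : D.integrand g₀ U B = 0 := by rw [hintg, hB, zero_mul]
      rw [this, zero_mul, abs_zero]
      simp only [hbound]; positivity
    · have hx : 0 ≤ B ⬝ᵥ B := Finset.sum_nonneg fun i _ => mul_self_nonneg (B i)
      exact hmaj B hB g₀ hg₀ _ (by rw [abs_of_nonneg (by positivity)])
  have htilt := abs_deriv_newTerm_le_tilted D e' (fun B => m₀ + m₂ / 2 * (B ⬝ᵥ B))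
    (fun B hB => hder B hB g₀ hg₀) hmI hpos
  have hnum := tiltedQuadMoment_le_of_quadDom prec hpd χ h0 h1 P Q (g := g₀) (U := U) hm₀ hm₂ hδ
    (fun B hB => hdom B hB g₀ hg₀) hMα hMδ
  have hnum' : ∫ B, D.integrand g₀ U B * (m₀ + m₂ / 2 * (B ⬝ᵥ B)) ∂(D.μ U)
      ≤ Real.exp a₀ * (m₀ * (Real.sqrt (prec U).det / Real.sqrt (prec U - α • (1 : Matrix κ κ ℝ)).det)
          + m₂ / δ * (Real.sqrt (prec U).det / Real.sqrt (prec U - (α + δ) • (1 : Matrix κ κ ℝ)).det)) := hnum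
  set K := m₀ * (Real.sqrt (prec U).det / Real.sqrt (prec U - α • (1 : Matrix κ κ ℝ)).det)
      + m₂ / δ * (Real.sqrt (prec U).det / Real.sqrt (prec U - (α + δ) • (1 : Matrix κ κ ℝ)).det) with hK
  set mass := ∫ B, χ U B * Real.exp (-(α / 2 * (B ⬝ᵥ B))) ∂(gaussProb (prec U)) with hmass_def
  have hm_nonneg : ∀ B : κ → ℝ, 0 ≤ m₀ + m₂ / 2 * (B ⬝ᵥ B) := fun B => by
    have hx : 0 ≤ B ⬝ᵥ B := Finset.sum_nonneg fun i _ => mul_self_nonneg (B i)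
    positivity
  have hnum0 : 0 ≤ ∫ B, D.integrand g₀ U B * (m₀ + m₂ / 2 * (B ⬝ᵥ B)) ∂(D.μ U) :=
    integral_nonneg fun B => mul_nonneg (D.integrand_nonneg g₀ U B) (hm_nonneg B)
  have hinv : (D.integral g₀ U)⁻¹ ≤ Real.exp a₀ / mass := by
    rw [inv_le_comm₀ hpos (div_pos (Real.exp_pos _) hmass), inv_div]
    calc mass / Real.exp a₀ = Real.exp (-a₀) * mass := by rw [Real.exp_neg, div_eq_inv_mul]
      _ ≤ D.integral g₀ U := hlow
  calc |(D.integral g₀ U)⁻¹ * ∫ B, D.integrand g₀ U B * e' g₀ B ∂(gaussProb (prec U))|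
      ≤ (D.integral g₀ U)⁻¹ * ∫ B, D.integrand g₀ U B * (m₀ + m₂ / 2 * (B ⬝ᵥ B)) ∂(D.μ U) := htilt
    _ ≤ (Real.exp a₀ / mass) * (Real.exp a₀ * K) :=
        mul_le_mul hinv hnum' hnum0 (div_nonneg (Real.exp_nonneg _) hmass.le)
    _ = Real.exp (2 * a₀) * K / mass := by
        rw [show (2 : ℝ) * a₀ = a₀ + a₀ by ring, Real.exp_add]
        ring

end Exponent

/-! ## §3. The cut-off channel of the last coupling, effective for the Gaussian body -/

section Cutoff

variable {X : Type*} {κ : Type} [Fintype κ] [DecidableEq κ]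
variable (prec : X → Matrix κ κ ℝ) (hpd : ∀ U, (prec U).PosDef) (χ : X → (κ → ℝ) → ℝ) (h0 : ∀ U B, 0 ≤ χ U B)
  (h1 : ∀ U B, χ U B ≤ 1) (P Q : ℝ → X → (κ → ℝ) → ℝ)

/-- **THE CUT-OFF CHANNEL, EFFECTIVE FOR THE GAUSSIAN BODY.**  Two windows `χ_U ≤ χ′_U` in `[0, 1]` whose difference lives on the
large field `{r ≤ |B_b|}` of finitely many coordinates `b ∈ S` (`χ′_U − χ_U ≤ χ′_U·Σ_{b∈S} 1{r ≤ |B_b|}`, `0 ≤ r`; nested product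
cut-offs, module 2's `gap_of_nested_product`); the (2.20)-type domination `|𝐏^{(k)} + {…}| ≤ a₀ + ½α|B|²` on the support of `χ′_U`;
`γ₂ ≥ 0` with `M − (α+γ₂)·1` positive definite; positive damped small-field mass of `χ_U`; measurable integrands.  Then
`𝐄′^{(k+1)}(g, U) − 𝐄^{(k+1)}(g, U) ≤ e^{−½γ₂r²} · (#S · e^{2a₀}·√(det M∕det(M − (α+γ₂)·1))) ∕ ∫ χ_U e^{−½α|B|²} dμ_{M⁻¹}` — with
`r = ε₁∕g_k` the large-field factor `exp(−½γ₂ε₁²∕g_k²)` of (2.22) times explicit Gaussian quantities.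
[cite: Balaban1988RG2Cluster, (2.20)–(2.22) p.16 and (2.25) p.17; Balaban1987RG1, (2.9) p.266 and (2.13) p.268] -/
theorem cutoffChannel_gaussian_le (S : Finset κ) {U : X} {g r γ₂ a₀ α : ℝ} (hr : 0 ≤ r) (hγ : 0 ≤ γ₂)
    (χ' : X → (κ → ℝ) → ℝ) (h0' : ∀ U B, 0 ≤ χ' U B) (h1' : ∀ U B, χ' U B ≤ 1) (hle : ∀ B, χ U B ≤ χ' U B)
    (hgap : ∀ B, χ' U B - χ U B ≤ χ' U B * ∑ b ∈ S, (if r ≤ |B b| then (1 : ℝ) else 0))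
    (hdom : ∀ B, χ' U B ≠ 0 → |P g U B + Q g U B| ≤ a₀ + α / 2 * (B ⬝ᵥ B))
    (hmeas : AEStronglyMeasurable (fun B => χ U B * Real.exp (P g U B + Q g U B)) (gaussProb (prec U)))
    (hmeas' : AEStronglyMeasurable (fun B => χ' U B * Real.exp (P g U B + Q g U B)) (gaussProb (prec U)))
    (hMα : (prec U - α • (1 : Matrix κ κ ℝ)).PosDef) (hM : (prec U - (α + γ₂) • (1 : Matrix κ κ ℝ)).PosDef)
    (hmass : 0 < ∫ B, χ U B * Real.exp (-(α / 2 * (B ⬝ᵥ B))) ∂(gaussProb (prec U))) :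
    FluctData.newTerm { FluctData.gaussian prec hpd χ h0 h1 P Q with χ := χ', χ_nonneg := h0', χ_le_one := h1' } g U
        - (FluctData.gaussian prec hpd χ h0 h1 P Q).newTerm g U
      ≤ Real.exp (-(γ₂ / 2 * r ^ 2)) *
          ((S.card : ℝ) * (Real.exp (2 * a₀) *
            (Real.sqrt (prec U).det / Real.sqrt (prec U - (α + γ₂) • (1 : Matrix κ κ ℝ)).det)))
          / ∫ B, χ U B * Real.exp (-(α / 2 * (B ⬝ᵥ B))) ∂(gaussProb (prec U)) := by
  set D := FluctData.gaussian prec hpd χ h0 h1 P Q with hD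
  have hμ : D.μ U = gaussProb (prec U) := rfl
  -- domination on the support of χ (⊆ support of χ′)
  have hdomχ : ∀ B, χ U B ≠ 0 → |P g U B + Q g U B| ≤ a₀ + α / 2 * (B ⬝ᵥ B) := by
    intro B hB
    refine hdom B fun h' => hB ?_
    exact le_antisymm ((hle B).trans h'.le) (h0 U B)
  -- the exponential majorant e^{a₀}e^{½α|B|²} and the integrability of both integrands
  have hmajI : ∀ c : ℝ, (prec U - c • (1 : Matrix κ κ ℝ)).PosDef →
      Integrable (fun B : κ → ℝ => Real.exp a₀ * Real.exp (c / 2 * (B ⬝ᵥ B))) (gaussProb (prec U)) := by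
    intro c hc
    rw [integrable_gaussProb_iff (hpd U)]
    have h := (integrable_gaussWeight hc).const_mul (Real.exp a₀)
    refine h.congr (Filter.Eventually.of_forall fun B => ?_)
    simp only [← gaussWeight_mul_exp_sq]
    ring
  have hptχ' : ∀ B, χ' U B * Real.exp (P g U B + Q g U B) ≤ Real.exp a₀ * Real.exp (α / 2 * (B ⬝ᵥ B)) := by
    intro B
    by_cases hB : χ' U B = 0
    · rw [hB, zero_mul]; positivity
    · have hb := (abs_le.1 (hdom B hB)).2
      calc χ' U B * Real.exp (P g U B + Q g U B) ≤ 1 * Real.exp (a₀ + α / 2 * (B ⬝ᵥ B)) :=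
            mul_le_mul (h1' U B) (Real.exp_le_exp.2 hb) (Real.exp_nonneg _) zero_le_one
        _ = Real.exp a₀ * Real.exp (α / 2 * (B ⬝ᵥ B)) := by rw [one_mul, Real.exp_add]
  have hint' : Integrable (FluctData.integrand { D with χ := χ', χ_nonneg := h0', χ_le_one := h1' } g U) (D.μ U) := by
    refine (hmajI α hMα).mono' hmeas' (Filter.Eventually.of_forall fun B => ?_)
    rw [Real.norm_eq_abs]
    show |χ' U B * Real.exp (P g U B + Q g U B)| ≤ _
    rw [abs_of_nonneg (mul_nonneg (h0' U B) (Real.exp_nonneg _))]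
    exact hptχ' B
  have hint : Integrable (D.integrand g U) (D.μ U) := by
    refine (hmajI α hMα).mono' hmeas (Filter.Eventually.of_forall fun B => ?_)
    rw [Real.norm_eq_abs]
    show |χ U B * Real.exp (P g U B + Q g U B)| ≤ _
    rw [abs_of_nonneg (mul_nonneg (h0 U B) (Real.exp_nonneg _))]
    exact (mul_le_mul_of_nonneg_right (hle B) (Real.exp_nonneg _)).trans (hptχ' B)
  -- tilted exponential moments are integrable and bounded (module 4)
  have hcoord : ∀ b : κ, ∀ B : κ → ℝ, (B b) ^ 2 ≤ B ⬝ᵥ B := by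
    intro b B
    rw [dotProduct, sq]
    exact Finset.single_le_sum (f := fun i => B i * B i) (fun i _ => mul_self_nonneg (B i)) (Finset.mem_univ b)
  have hmom : ∀ b ∈ S, Integrable (fun B => χ' U B * Real.exp (D.exponent g U B) * Real.exp (γ₂ / 2 * (B b) ^ 2)) (D.μ U) := by
    intro b _
    refine (hmajI (α + γ₂) hM).mono' (hmeas'.mul (Continuous.aestronglyMeasurable (by fun_prop)))
      (Filter.Eventually.of_forall fun B => ?_)
    rw [Real.norm_eq_abs]
    show |χ' U B * Real.exp (P g U B + Q g U B) * Real.exp (γ₂ / 2 * (B b) ^ 2)| ≤ _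
    rw [abs_of_nonneg (mul_nonneg (mul_nonneg (h0' U B) (Real.exp_nonneg _)) (Real.exp_nonneg _))]
    have hl : γ₂ / 2 * (B b) ^ 2 ≤ γ₂ / 2 * (B ⬝ᵥ B) := mul_le_mul_of_nonneg_left (hcoord b B) (by linarith)
    calc χ' U B * Real.exp (P g U B + Q g U B) * Real.exp (γ₂ / 2 * (B b) ^ 2)
        ≤ (Real.exp a₀ * Real.exp (α / 2 * (B ⬝ᵥ B))) * Real.exp (γ₂ / 2 * (B ⬝ᵥ B)) :=
          mul_le_mul (hptχ' B) (Real.exp_le_exp.2 hl) (Real.exp_nonneg _) (by positivity)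
      _ = Real.exp a₀ * Real.exp ((α + γ₂) / 2 * (B ⬝ᵥ B)) := by
          rw [mul_assoc, ← Real.exp_add]; ring_nf
  -- positivity of the χ-integral through the damped mass (module 4's lower bound)
  have hintW : Integrable (fun B => gaussWeight (prec U) B * (χ U B * Real.exp (P g U B + Q g U B))) :=
    (integrable_gaussProb_iff (hpd U) _).1 hint
  have hlow := integral_gaussian_ge_of_quadDom prec hpd χ h0 h1 P Q hdomχ hintW
  have hpos : 0 < D.integral g U := (mul_pos (Real.exp_pos _) hmass).trans_le hlow
  -- module 2's (2.22) device on the body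
  have hstep := newTerm_sub_newTerm_le_largeField D S (fun b B => B b) hr hγ χ' h0' h1' hint hint' hmom hpos hle hgap
  -- numerators by module 4, denominator by the lower bound
  have hnum : ∀ b ∈ S, ∫ B, χ' U B * Real.exp (D.exponent g U B) * Real.exp (γ₂ / 2 * (B b) ^ 2) ∂(D.μ U)
      ≤ Real.exp a₀ * (Real.sqrt (prec U).det / Real.sqrt (prec U - (α + γ₂) • (1 : Matrix κ κ ℝ)).det) :=
    fun b _ => tiltedExpMoment_le_of_quadDom prec hpd P Q hγ (fun B => B b) (hcoord b) χ' h0' h1' hdom hM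
  set Rq := Real.sqrt (prec U).det / Real.sqrt (prec U - (α + γ₂) • (1 : Matrix κ κ ℝ)).det with hRq
  set mass := ∫ B, χ U B * Real.exp (-(α / 2 * (B ⬝ᵥ B))) ∂(gaussProb (prec U)) with hmass_def
  have hsum : ∑ b ∈ S, ∫ B, χ' U B * Real.exp (D.exponent g U B) * Real.exp (γ₂ / 2 * (B b) ^ 2) ∂(D.μ U)
      ≤ (S.card : ℝ) * (Real.exp a₀ * Rq) := by
    have h := Finset.sum_le_sum hnum
    rwa [Finset.sum_const, nsmul_eq_mul] at h
  have hsum0 : 0 ≤ ∑ b ∈ S, ∫ B, χ' U B * Real.exp (D.exponent g U B) * Real.exp (γ₂ / 2 * (B b) ^ 2) ∂(D.μ U) :=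
    Finset.sum_nonneg fun b _ => integral_nonneg fun B =>
      mul_nonneg (mul_nonneg (h0' U B) (Real.exp_nonneg _)) (Real.exp_nonneg _)
  have hinv : (D.integral g U)⁻¹ ≤ Real.exp a₀ / mass := by
    rw [inv_le_comm₀ hpos (div_pos (Real.exp_pos _) hmass), inv_div]
    calc mass / Real.exp a₀ = Real.exp (-a₀) * mass := by rw [Real.exp_neg, div_eq_inv_mul]
      _ ≤ D.integral g U := hlow
  calc FluctData.newTerm { D with χ := χ', χ_nonneg := h0', χ_le_one := h1' } g U - D.newTerm g U
      ≤ Real.exp (-(γ₂ / 2 * r ^ 2)) *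
          (∑ b ∈ S, ∫ B, χ' U B * Real.exp (D.exponent g U B) * Real.exp (γ₂ / 2 * (B b) ^ 2) ∂(D.μ U)) /
          D.integral g U := hstep
    _ = Real.exp (-(γ₂ / 2 * r ^ 2)) *
          (∑ b ∈ S, ∫ B, χ' U B * Real.exp (D.exponent g U B) * Real.exp (γ₂ / 2 * (B b) ^ 2) ∂(D.μ U)) *
          (D.integral g U)⁻¹ := by rw [div_eq_mul_inv]
    _ ≤ Real.exp (-(γ₂ / 2 * r ^ 2)) * ((S.card : ℝ) * (Real.exp a₀ * Rq)) * (Real.exp a₀ / mass) :=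
        mul_le_mul (mul_le_mul_of_nonneg_left hsum (Real.exp_nonneg _)) hinv (inv_nonneg.2 hpos.le)
          (mul_nonneg (Real.exp_nonneg _) (mul_nonneg (Nat.cast_nonneg _) (mul_nonneg (Real.exp_nonneg _)
            (div_nonneg (Real.sqrt_nonneg _) (Real.sqrt_nonneg _)))))
    _ = Real.exp (-(γ₂ / 2 * r ^ 2)) * ((S.card : ℝ) * (Real.exp (2 * a₀) * Rq)) / mass := by
        rw [show (2 : ℝ) * a₀ = a₀ + a₀ by ring, Real.exp_add]
        ring

end Cutoff

/-! ## §4 (v1.1, APPEND-ONLY; §§1–3 byte-identical). The effective `g_k`-LIPSCHITZ CONSTANT of the Gaussian new term on a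
coupling window — the input `hN` of `B12Eq213HistoryTower.abs_action_sub_action_le_tower_of_lip` -/

section LipschitzWindow

variable {X : Type*} {κ : Type} [Fintype κ] [DecidableEq κ]
variable (prec : X → Matrix κ κ ℝ) (hpd : ∀ U, (prec U).PosDef) (χ : X → (κ → ℝ) → ℝ) (h0 : ∀ U B, 0 ≤ χ U B)
  (h1 : ∀ U B, χ U B ≤ 1) (P Q : ℝ → X → (κ → ℝ) → ℝ)

/-- **THE LAST-COUPLING MODULUS ON A WINDOW, EFFECTIVE FOR THE GAUSSIAN BODY.**  If the hypotheses of
`hasDerivAt_newTerm_gaussian_of_quadDom` hold on a whole coupling ball `|g − c| < ρ` (exponent `g`-differentiable on the small-field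
support with the two (2.20)-type dominations, measurability, `M − α·1` and `M − (α+δ)·1` positive definite, positive damped mass),
then for all `g, g′` in that ball
`|𝐄^{(k+1)}(g′, U) − 𝐄^{(k+1)}(g, U)| ≤ (e^{2a₀}·(m₀R(α) + (m₂∕δ)R(α+δ)) ∕ ∫ χ_U e^{−½α|B|²} dμ_{M⁻¹}) · |g′ − g|`
(mean value theorem on the convex ball from the pointwise derivative bound) — p. 263's clause as a LIPSCHITZ MODULUS with an explicit
Gaussian constant; the new-term-level input of the history tower (`B12Eq213HistoryTower.abs_action_sub_action_le_tower_of_lip`).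
[cite: Balaban1987RG1, (2.13) p.268 and p.263 (clause before (1.18)); Balaban1988RG2Cluster, (2.20) p.16 and (2.25) p.17] -/
theorem abs_newTerm_sub_newTerm_gaussian_of_quadDom {U : X} {c ρ a₀ α δ m₀ m₂ : ℝ} (e' : ℝ → (κ → ℝ) → ℝ)
    (hm₀ : 0 ≤ m₀) (hm₂ : 0 ≤ m₂) (hδ : 0 < δ)
    (hmeas : ∀ g ∈ Metric.ball c ρ,
      AEStronglyMeasurable (fun B => χ U B * Real.exp (P g U B + Q g U B)) (gaussProb (prec U)))
    (he' : ∀ g ∈ Metric.ball c ρ, AEStronglyMeasurable (e' g) (gaussProb (prec U)))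
    (hdiff : ∀ B, χ U B ≠ 0 → ∀ g ∈ Metric.ball c ρ, HasDerivAt (fun g => P g U B + Q g U B) (e' g B) g)
    (hdom : ∀ B, χ U B ≠ 0 → ∀ g ∈ Metric.ball c ρ, |P g U B + Q g U B| ≤ a₀ + α / 2 * (B ⬝ᵥ B))
    (hder : ∀ B, χ U B ≠ 0 → ∀ g ∈ Metric.ball c ρ, |e' g B| ≤ m₀ + m₂ / 2 * (B ⬝ᵥ B))
    (hMα : (prec U - α • (1 : Matrix κ κ ℝ)).PosDef) (hMδ : (prec U - (α + δ) • (1 : Matrix κ κ ℝ)).PosDef)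
    (hmass : 0 < ∫ B, χ U B * Real.exp (-(α / 2 * (B ⬝ᵥ B))) ∂(gaussProb (prec U)))
    {g g' : ℝ} (hg : g ∈ Metric.ball c ρ) (hg' : g' ∈ Metric.ball c ρ) :
    |(FluctData.gaussian prec hpd χ h0 h1 P Q).newTerm g' U - (FluctData.gaussian prec hpd χ h0 h1 P Q).newTerm g U|
      ≤ (Real.exp (2 * a₀) * (m₀ * (Real.sqrt (prec U).det / Real.sqrt (prec U - α • (1 : Matrix κ κ ℝ)).det)
            + m₂ / δ * (Real.sqrt (prec U).det / Real.sqrt (prec U - (α + δ) • (1 : Matrix κ κ ℝ)).det))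
          / ∫ B, χ U B * Real.exp (-(α / 2 * (B ⬝ᵥ B))) ∂(gaussProb (prec U))) * |g' - g| := by
  set Λ := Real.exp (2 * a₀) * (m₀ * (Real.sqrt (prec U).det / Real.sqrt (prec U - α • (1 : Matrix κ κ ℝ)).det)
      + m₂ / δ * (Real.sqrt (prec U).det / Real.sqrt (prec U - (α + δ) • (1 : Matrix κ κ ℝ)).det))
      / ∫ B, χ U B * Real.exp (-(α / 2 * (B ⬝ᵥ B))) ∂(gaussProb (prec U)) with hΛ
  -- at every point of the ball: a derivative bounded by Λ (from a small ball inside the window)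
  have hpt : ∀ g₀ ∈ Metric.ball c ρ, ∃ v : ℝ,
      HasDerivAt (fun g => (FluctData.gaussian prec hpd χ h0 h1 P Q).newTerm g U) v g₀ ∧ |v| ≤ Λ := by
    intro g₀ hg₀
    have hε : 0 < ρ - dist g₀ c := sub_pos.2 (Metric.mem_ball.1 hg₀)
    have hsub : Metric.ball g₀ (ρ - dist g₀ c) ⊆ Metric.ball c ρ :=
      Metric.ball_subset_ball' (by linarith)
    obtain ⟨hd, hb⟩ := hasDerivAt_newTerm_gaussian_of_quadDom prec hpd χ h0 h1 P Q e' hε hm₀ hm₂ hδ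
      (fun g hg => hmeas g (hsub hg)) (he' g₀ hg₀) (fun B hB g hg => hdiff B hB g (hsub hg))
      (fun B hB g hg => hdom B hB g (hsub hg)) (fun B hB g hg => hder B hB g (hsub hg)) hMα hMδ hmass
    exact ⟨_, hd, hb⟩
  choose! v hv using hpt
  have key := Convex.norm_image_sub_le_of_norm_hasDerivWithin_le
    (f := fun g => (FluctData.gaussian prec hpd χ h0 h1 P Q).newTerm g U) (f' := v) (s := Metric.ball c ρ)
    (fun x hx => (hv x hx).1.hasDerivWithinAt) (fun x hx => by simpa [Real.norm_eq_abs] using (hv x hx).2)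
    (convex_ball c ρ) hg hg'
  simpa [Real.norm_eq_abs] using key

end LipschitzWindow

end Literature.MathematicalPhysics.QuantumFieldTheory.Balaban1983to89.B12Eq213GaussianLastCoupling
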